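import Summits.KontsevichZagierPeriods.KontsevichZagierPeriods.Theorems.ValuedFieldSpecialisationParametricLiftingStrength
import Summits.KontsevichZagierPeriods.KontsevichZagierPeriods.Theorems.ValuedFieldSpecialisationParametricLiftingTightnessUnfibred

/-!
# Route ValuedFieldSpecialisation — crux `ParametricLifting` (stmt-KontsevichZagierPeriods-3498):
REGULARISED CERTIFICATES FORM A SATURATED SUBGROUP (composition of sector instances)

Helper (`--supports`) for item stmt-KontsevichZagierPeriods-3498 (line `registered`, lead c6). Write,
for a formal combination `x : KZ.FormalRep`,

  `RegNet x :≡ ∃ k d m R r₀ g, (∀ i, KZ.IsDominatedFamily (R i) (r₀ i) (g i)) ∧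
      (Σ mᵢ [Rᵢ]) ∈ KZ.fibredRelations ∧ (Σ mᵢ [r₀ᵢ]) − x ∈ KZ.relations`

("`x` is certified by a REGULARISED move chain": it is, modulo honest moves, the special-fibre class
of a dominated fibred relation) — exactly the body of the kernel form KF of the crux
(`parametricLifting_iff_kernelForm`: PL ⇔ every `x ∈ ker KZ.eval` is `RegNet`), written out in each
statement below (no definition is introduced). This file records the bookkeeping that makes SECTOR
INSTANCES of the crux (such as the Frullani pair, `frullani_parametricLifting`) COMPOSABLE:

* `regNet_of_mem_relations` — honest relations are regularised certificates (empty net, `k = 0`);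
* `regNet_neg`, `regNet_add`, `regNet_sub` — closure under the group operations (negate the
  coefficients; concatenate the nets, `exists_net_append`);
* `regNet_of_regNet_of_sub_mem_relations` — saturation under `KZ.relations`;
* `eval_eq_zero_of_regNet` — regularised certificates are value-sound (the value shadow
  `eval_specialFibre_eq_zero` and soundness of the moves): `relations ⊆ RegNet ⊆ ker eval`;
* pair level: `parametricLifting_iff_forall_regNet` (the crux, unfolded: every equal-valued rational
  pair `(r, r')` has `RegNet ([r] − [r'])`), and `regNet_pair_refl/symm/trans`,
  `regNet_pair_of_equivalent` — the pairs certified by regularised chains form an equivalence relation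
  containing move-equivalence, so a sector instance may be pre- and post-composed with honest chains
  and with other sector instances.

Sources: M. Kontsevich, D. Zagier, *Periods* (2001), §1.2; A. Huber, S. Müller-Stach, *Periods and
Nori Motives* (2017), Rem. 13.2.2 (kernel form). The fibred/dominated vocabulary is this route's
(`KZFibredRelations.lean`, `KZDominatedFamily.lean`). No new definitions.
-/

noncomputable section

namespace Summit.KontsevichZagierPeriods.ValuedFieldSpecialisation

open MeasureTheory Set Filter
open scoped Topology
open Literature.NumberTheory.Transcendental Literature.NumberTheory.Transcendental.KZ

/-! ### The subgroup of regularised certificates -/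

/-- **Honest relations are regularised certificates** (the empty net: `k = 0`, `G = 0`).
[Kontsevich–Zagier 2001, §1.2] [folklore] -/
theorem regNet_of_mem_relations :
    ∀ (x : KZ.FormalRep), x ∈ KZ.relations → ∃ (k : ℕ) (d : Fin k → ℕ) (m : Fin k → ℤ) (R : (i : Fin k) → KZ.IntegralRep (d i + 1)) (r₀ g : (i : Fin k) → KZ.IntegralRep (d i)), (∀ i, KZ.IsDominatedFamily (R i) (r₀ i) (g i)) ∧ (∑ i, m i • KZ.of (R i)) ∈ KZ.fibredRelations ∧ (∑ i, m i • KZ.of (r₀ i)) - x ∈ KZ.relations := by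
  intro x hx
  refine ⟨0, Fin.elim0, Fin.elim0, fun i => i.elim0, fun i => i.elim0, fun i => i.elim0,
    fun i => i.elim0, ?_, ?_⟩
  · simp [fibredRelations.zero_mem]
  · simpa using relations.neg_mem hx

/-- **Regularised certificates are closed under negation** (negate the coefficients of the net).
[Kontsevich–Zagier 2001, §1.2] [folklore] -/
theorem regNet_neg {x : KZ.FormalRep}
    (hx : ∃ (k : ℕ) (d : Fin k → ℕ) (m : Fin k → ℤ) (R : (i : Fin k) → KZ.IntegralRep (d i + 1))
      (r₀ g : (i : Fin k) → KZ.IntegralRep (d i)), (∀ i, KZ.IsDominatedFamily (R i) (r₀ i) (g i)) ∧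
      (∑ i, m i • KZ.of (R i)) ∈ KZ.fibredRelations ∧ (∑ i, m i • KZ.of (r₀ i)) - x ∈ KZ.relations) :
    ∃ (k : ℕ) (d : Fin k → ℕ) (m : Fin k → ℤ) (R : (i : Fin k) → KZ.IntegralRep (d i + 1))
      (r₀ g : (i : Fin k) → KZ.IntegralRep (d i)), (∀ i, KZ.IsDominatedFamily (R i) (r₀ i) (g i)) ∧
      (∑ i, m i • KZ.of (R i)) ∈ KZ.fibredRelations ∧
      (∑ i, m i • KZ.of (r₀ i)) - (-x) ∈ KZ.relations := by
  obtain ⟨k, d, m, R, r₀, g, hdom, hG, hfib⟩ := hx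
  refine ⟨k, d, fun i => -m i, R, r₀, g, hdom, ?_, ?_⟩
  · simpa [neg_zsmul, Finset.sum_neg_distrib] using fibredRelations.neg_mem hG
  · have h := relations.neg_mem hfib
    simp only [neg_zsmul, Finset.sum_neg_distrib, sub_neg_eq_add]
    convert h using 1
    abel

/-- **Regularised certificates are closed under addition** (concatenate the two nets,
`exists_net_append`; `fibredRelations` and `relations` are subgroups).
[Kontsevich–Zagier 2001, §1.2] [folklore] -/
theorem regNet_add :
    ∀ (x y : KZ.FormalRep), (∃ (k : ℕ) (d : Fin k → ℕ) (m : Fin k → ℤ) (R : (i : Fin k) → KZ.IntegralRep (d i + 1)) (r₀ g : (i : Fin k) → KZ.IntegralRep (d i)), (∀ i, KZ.IsDominatedFamily (R i) (r₀ i) (g i)) ∧ (∑ i, m i • KZ.of (R i)) ∈ KZ.fibredRelations ∧ (∑ i, m i • KZ.of (r₀ i)) - x ∈ KZ.relations) → (∃ (k : ℕ) (d : Fin k → ℕ) (m : Fin k → ℤ) (R : (i : Fin k) → KZ.IntegralRep (d i + 1)) (r₀ g : (i : Fin k) → KZ.IntegralRep (d i)), (∀ i, KZ.IsDominatedFamily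 (R i) (r₀ i) (g i)) ∧ (∑ i, m i • KZ.of (R i)) ∈ KZ.fibredRelations ∧ (∑ i, m i • KZ.of (r₀ i)) - y ∈ KZ.relations) → ∃ (k : ℕ) (d : Fin k → ℕ) (m : Fin k → ℤ) (R : (i : Fin k) → KZ.IntegralRep (d i + 1)) (r₀ g : (i : Fin k) → KZ.IntegralRep (d i)), (∀ i, KZ.IsDominatedFamily (R i) (r₀ i) (g i)) ∧ (∑ i, m i • KZ.of (R i)) ∈ KZ.fibredRelations ∧ (∑ i, m i • KZ.of (r₀ i)) - (x + y) ∈ KZ.relations := by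
  rintro x y ⟨k₁, d₁, m₁, R₁, r₁, g₁, hdom₁, hG₁, hfib₁⟩ ⟨k₂, d₂, m₂, R₂, r₂, g₂, hdom₂, hG₂, hfib₂⟩
  obtain ⟨d, m, R, r₀, g, hdom, hGsum, hrsum⟩ :=
    exists_net_append m₁ m₂ R₁ r₁ g₁ R₂ r₂ g₂ hdom₁ hdom₂
  refine ⟨k₁ + k₂, d, m, R, r₀, g, hdom, ?_, ?_⟩
  · rw [hGsum]
    exact fibredRelations.add_mem hG₁ hG₂
  · rw [hrsum]
    have h := relations.add_mem hfib₁ hfib₂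
    convert h using 1
    abel

/-- **Regularised certificates are closed under subtraction.** [Kontsevich–Zagier 2001, §1.2] [folklore] -/
theorem regNet_sub {x y : KZ.FormalRep}
    (hx : ∃ (k : ℕ) (d : Fin k → ℕ) (m : Fin k → ℤ) (R : (i : Fin k) → KZ.IntegralRep (d i + 1))
      (r₀ g : (i : Fin k) → KZ.IntegralRep (d i)), (∀ i, KZ.IsDominatedFamily (R i) (r₀ i) (g i)) ∧
      (∑ i, m i • KZ.of (R i)) ∈ KZ.fibredRelations ∧ (∑ i, m i • KZ.of (r₀ i)) - x ∈ KZ.relations)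
    (hy : ∃ (k : ℕ) (d : Fin k → ℕ) (m : Fin k → ℤ) (R : (i : Fin k) → KZ.IntegralRep (d i + 1))
      (r₀ g : (i : Fin k) → KZ.IntegralRep (d i)), (∀ i, KZ.IsDominatedFamily (R i) (r₀ i) (g i)) ∧
      (∑ i, m i • KZ.of (R i)) ∈ KZ.fibredRelations ∧ (∑ i, m i • KZ.of (r₀ i)) - y ∈ KZ.relations) :
    ∃ (k : ℕ) (d : Fin k → ℕ) (m : Fin k → ℤ) (R : (i : Fin k) → KZ.IntegralRep (d i + 1))
      (r₀ g : (i : Fin k) → KZ.IntegralRep (d i)), (∀ i, KZ.IsDominatedFamily (R i) (r₀ i) (g i)) ∧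
      (∑ i, m i • KZ.of (R i)) ∈ KZ.fibredRelations ∧
      (∑ i, m i • KZ.of (r₀ i)) - (x - y) ∈ KZ.relations := by
  simpa [sub_eq_add_neg] using regNet_add x (-y) hx (regNet_neg hy)

/-- **Saturation**: a formal combination congruent modulo honest relations to a regularised
certificate is one (same net). [Kontsevich–Zagier 2001, §1.2] [folklore] -/
theorem regNet_of_regNet_of_sub_mem_relations {x y : KZ.FormalRep}
    (hx : ∃ (k : ℕ) (d : Fin k → ℕ) (m : Fin k → ℤ) (R : (i : Fin k) → KZ.IntegralRep (d i + 1))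
      (r₀ g : (i : Fin k) → KZ.IntegralRep (d i)), (∀ i, KZ.IsDominatedFamily (R i) (r₀ i) (g i)) ∧
      (∑ i, m i • KZ.of (R i)) ∈ KZ.fibredRelations ∧ (∑ i, m i • KZ.of (r₀ i)) - x ∈ KZ.relations)
    (hxy : x - y ∈ KZ.relations) :
    ∃ (k : ℕ) (d : Fin k → ℕ) (m : Fin k → ℤ) (R : (i : Fin k) → KZ.IntegralRep (d i + 1))
      (r₀ g : (i : Fin k) → KZ.IntegralRep (d i)), (∀ i, KZ.IsDominatedFamily (R i) (r₀ i) (g i)) ∧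
      (∑ i, m i • KZ.of (R i)) ∈ KZ.fibredRelations ∧
      (∑ i, m i • KZ.of (r₀ i)) - y ∈ KZ.relations := by
  obtain ⟨k, d, m, R, r₀, g, hdom, hG, hfib⟩ := hx
  refine ⟨k, d, m, R, r₀, g, hdom, hG, ?_⟩
  have h := relations.add_mem hfib hxy
  rwa [sub_add_sub_cancel] at h

/-- **Regularised certificates are value-sound**: `RegNet x → KZ.eval x = 0` (the special-fibre class
of a dominated fibred relation evaluates to `0`, `eval_specialFibre_eq_zero`, and honest relations are
in the kernel of `eval`, `KZ.relations_le_ker_eval_holds`). So `KZ.relations ⊆ RegNet ⊆ ker KZ.eval`.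
[Kontsevich–Zagier 2001, §1.2] [folklore] -/
theorem eval_eq_zero_of_regNet :
    ∀ (x : KZ.FormalRep), (∃ (k : ℕ) (d : Fin k → ℕ) (m : Fin k → ℤ) (R : (i : Fin k) → KZ.IntegralRep (d i + 1)) (r₀ g : (i : Fin k) → KZ.IntegralRep (d i)), (∀ i, KZ.IsDominatedFamily (R i) (r₀ i) (g i)) ∧ (∑ i, m i • KZ.of (R i)) ∈ KZ.fibredRelations ∧ (∑ i, m i • KZ.of (r₀ i)) - x ∈ KZ.relations) → KZ.eval x = 0 := by
  rintro x ⟨k, d, m, R, r₀, g, hdom, hG, hfib⟩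
  have h0 : eval (∑ i, m i • of (r₀ i)) = 0 := eval_specialFibre_eq_zero m hdom hG
  have h1 : eval ((∑ i, m i • of (r₀ i)) - x) = 0 := relations_le_ker_eval_holds hfib
  rwa [map_sub, h0, zero_sub, neg_eq_zero] at h1

/-! ### Pair level: the crux unfolded, and composition of sector instances -/

/-- **The crux, unfolded.** `ParametricLifting` says exactly: for every pair of rational
representations with equal value, `[r] − [r']` is a regularised certificate (eliminate the bound
variable `G = Σ mᵢ [Rᵢ]`; the clauses are definitionally `KZ.IsDominatedFamily` and the closure is
definitionally `KZ.fibredRelations`). [Kontsevich–Zagier 2001, §1.2] [folklore] -/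
theorem parametricLifting_iff_forall_regNet :
    Summit.KontsevichZagierPeriods.KontsevichZagierPeriods.Theses.ValuedFieldSpecialisation.ParametricLifting ↔ ∀ ⦃n n' : ℕ⦄ (r : KZ.IntegralRep n) (r' : KZ.IntegralRep n'), r.IsRational → r'.IsRational → r.value = r'.value → ∃ (k : ℕ) (d : Fin k → ℕ) (m : Fin k → ℤ) (R : (i : Fin k) → KZ.IntegralRep (d i + 1)) (r₀ g : (i : Fin k) → KZ.IntegralRep (d i)), (∀ i, KZ.IsDominatedFamily (R i) (r₀ i) (g i)) ∧ (∑ i, m i • KZ.of (R i)) ∈ KZ.fibredRelations ∧ (∑ i, m i • KZ.of (r₀ i)) - (KZ.of r - KZ.of r') ∈ KZ.relations := by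
  constructor
  · intro hPL n n' r r' hr hr' hval
    obtain ⟨G, hG, k, d, m, R, r₀, g, hdom, rfl, hfib⟩ := hPL r r' hr hr' hval
    exact ⟨k, d, m, R, r₀, g, hdom, hG, hfib⟩
  · intro h n n' r r' hr hr' hval
    obtain ⟨k, d, m, R, r₀, g, hdom, hG, hfib⟩ := h r r' hr hr' hval
    exact ⟨_, hG, k, d, m, R, r₀, g, hdom, rfl, hfib⟩

/-- **Move-equivalent pairs are certified** (empty net). [Kontsevich–Zagier 2001, §1.2] [folklore] -/
theorem regNet_pair_of_equivalent {n n' : ℕ} {r : KZ.IntegralRep n} {r' : KZ.IntegralRep n'}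
    (h : KZ.Equivalent r r') :
    ∃ (k : ℕ) (d : Fin k → ℕ) (m : Fin k → ℤ) (R : (i : Fin k) → KZ.IntegralRep (d i + 1))
      (r₀ g : (i : Fin k) → KZ.IntegralRep (d i)), (∀ i, KZ.IsDominatedFamily (R i) (r₀ i) (g i)) ∧
      (∑ i, m i • KZ.of (R i)) ∈ KZ.fibredRelations ∧
      (∑ i, m i • KZ.of (r₀ i)) - (KZ.of r - KZ.of r') ∈ KZ.relations :=
  regNet_of_mem_relations _ h

/-- **Reflexivity** of the certified-pair relation. [Kontsevich–Zagier 2001, §1.2] [folklore] -/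
theorem regNet_pair_refl {n : ℕ} (r : KZ.IntegralRep n) :
    ∃ (k : ℕ) (d : Fin k → ℕ) (m : Fin k → ℤ) (R : (i : Fin k) → KZ.IntegralRep (d i + 1))
      (r₀ g : (i : Fin k) → KZ.IntegralRep (d i)), (∀ i, KZ.IsDominatedFamily (R i) (r₀ i) (g i)) ∧
      (∑ i, m i • KZ.of (R i)) ∈ KZ.fibredRelations ∧
      (∑ i, m i • KZ.of (r₀ i)) - (KZ.of r - KZ.of r) ∈ KZ.relations :=
  regNet_pair_of_equivalent (Equivalent.refl r)

/-- **Symmetry** of the certified-pair relation (negate the net). [Kontsevich–Zagier 2001, §1.2] [folklore] -/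
theorem regNet_pair_symm {n n' : ℕ} {r : KZ.IntegralRep n} {r' : KZ.IntegralRep n'}
    (h : ∃ (k : ℕ) (d : Fin k → ℕ) (m : Fin k → ℤ) (R : (i : Fin k) → KZ.IntegralRep (d i + 1))
      (r₀ g : (i : Fin k) → KZ.IntegralRep (d i)), (∀ i, KZ.IsDominatedFamily (R i) (r₀ i) (g i)) ∧
      (∑ i, m i • KZ.of (R i)) ∈ KZ.fibredRelations ∧
      (∑ i, m i • KZ.of (r₀ i)) - (KZ.of r - KZ.of r') ∈ KZ.relations) :
    ∃ (k : ℕ) (d : Fin k → ℕ) (m : Fin k → ℤ) (R : (i : Fin k) → KZ.IntegralRep (d i + 1))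
      (r₀ g : (i : Fin k) → KZ.IntegralRep (d i)), (∀ i, KZ.IsDominatedFamily (R i) (r₀ i) (g i)) ∧
      (∑ i, m i • KZ.of (R i)) ∈ KZ.fibredRelations ∧
      (∑ i, m i • KZ.of (r₀ i)) - (KZ.of r' - KZ.of r) ∈ KZ.relations := by
  simpa only [neg_sub] using regNet_neg h

/-- **Transitivity** of the certified-pair relation (concatenate the nets): sector instances of the
crux compose with each other and with honest move chains. [Kontsevich–Zagier 2001, §1.2] [folklore] -/
theorem regNet_pair_trans :
    ∀ ⦃n n' n'' : ℕ⦄ (r : KZ.IntegralRep n) (r' : KZ.IntegralRep n') (r'' : KZ.IntegralRep n''), (∃ (k : ℕ) (d : Fin k → ℕ) (m : Fin k → ℤ) (R : (i : Fin k) → KZ.IntegralRep (d i + 1)) (r₀ g : (i : Fin k) → KZ.IntegralRep (d i)), (∀ i, KZ.IsDominatedFamily (R i) (r₀ i) (g i)) ∧ (∑ i, m i • KZ.of (R i)) ∈ KZ.fibredRelations ∧ (∑ i, m i • KZ.of (r₀ i)) - (KZ.of r - KZ.of r') ∈ KZ.relations) → (∃ (k : ℕ) (d : Fin k → ℕ)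 (m : Fin k → ℤ) (R : (i : Fin k) → KZ.IntegralRep (d i + 1)) (r₀ g : (i : Fin k) → KZ.IntegralRep (d i)), (∀ i, KZ.IsDominatedFamily (R i) (r₀ i) (g i)) ∧ (∑ i, m i • KZ.of (R i)) ∈ KZ.fibredRelations ∧ (∑ i, m i • KZ.of (r₀ i)) - (KZ.of r' - KZ.of r'') ∈ KZ.relations) → ∃ (k : ℕ) (d : Fin k → ℕ) (m : Fin k → ℤ) (R : (i : Fin k) → KZ.IntegralRep (d i + 1)) (r₀ g : (i : Fin k) → KZ.IntegralRep (d i)), (∀ i, KZ.IsDominatedFamily (R i) (r₀ i) (g i)) ∧ (∑ i, m i • KZ.of (R i)) ∈ KZ.fibredRelations ∧ (∑ i, m i • KZ.of (r₀ i)) - (KZ.of r - KZ.of r'') ∈ KZ.relations := by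
  intro n n' n'' r r' r'' h₁ h₂
  have h := regNet_add _ _ h₁ h₂
  rwa [sub_add_sub_cancel] at h

/-- **Pre- and post-composition with honest chains**: if `r ~ a` and `b ~ r'` by honest moves and the
pair `(a, b)` is certified by a regularised net, so is `(r, r')`. [Kontsevich–Zagier 2001, §1.2] [folklore] -/
theorem regNet_pair_of_equivalent_of_regNet_pair_of_equivalent {n n' l l' : ℕ}
    {r : KZ.IntegralRep n} {a : KZ.IntegralRep l} {b : KZ.IntegralRep l'} {r' : KZ.IntegralRep n'}
    (hra : KZ.Equivalent r a)
    (hab : ∃ (k : ℕ) (d : Fin k → ℕ) (m : Fin k → ℤ) (R : (i : Fin k) → KZ.IntegralRep (d i + 1))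
      (r₀ g : (i : Fin k) → KZ.IntegralRep (d i)), (∀ i, KZ.IsDominatedFamily (R i) (r₀ i) (g i)) ∧
      (∑ i, m i • KZ.of (R i)) ∈ KZ.fibredRelations ∧
      (∑ i, m i • KZ.of (r₀ i)) - (KZ.of a - KZ.of b) ∈ KZ.relations)
    (hbr' : KZ.Equivalent b r') :
    ∃ (k : ℕ) (d : Fin k → ℕ) (m : Fin k → ℤ) (R : (i : Fin k) → KZ.IntegralRep (d i + 1))
      (r₀ g : (i : Fin k) → KZ.IntegralRep (d i)), (∀ i, KZ.IsDominatedFamily (R i) (r₀ i) (g i)) ∧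
      (∑ i, m i • KZ.of (R i)) ∈ KZ.fibredRelations ∧
      (∑ i, m i • KZ.of (r₀ i)) - (KZ.of r - KZ.of r') ∈ KZ.relations :=
  regNet_pair_trans r b r' (regNet_pair_trans r a b (regNet_pair_of_equivalent hra) hab)
    (regNet_pair_of_equivalent hbr')

end Summit.KontsevichZagierPeriods.ValuedFieldSpecialisation
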